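import Summits.Ventures.HodgeRepro2.T5FiniteMultiplicity

/-!
# T5DecompositionTransport — a discrete decomposition with finite multiplicities transports along
a unitary intertwiner

Cell pub-hodge-repro2, seat p5, Tier 5 (route/T5-N4-p5.md, N4.3 v13 (B1)–(B2)).  Rows 48–59 prove
[DE] Theorem 9.2.2 for Mathlib's left cosets `G ⧸ Γ` with the LEFT regular representation; [DE]
uses right cosets `Γ\G` with the RIGHT regular representation, and the two are exchanged by the
unitary pullback along the inversion `Γx ↦ x⁻¹Γ`.  This file is the abstract transport: if
`Ψ : E₁ ≃ₗᵢ[ℂ] E₂` intertwines two representations (`Ψ (ρ₁ g v) = ρ₂ g (Ψ v)`), then every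
decomposition of `E₂` of the shape delivered by rows 49 / 53 pulls back to one of `E₁`:

* `pull Ψ U := U.comap Ψ` — closed (`isClosed_pull`), stable (`stable_pull`), non-zero
  (`pull_ne_bot`), IRREDUCIBLE (`irreducibleOn_pull`) whenever `U` is;
* `isOrtho_pull`: orthogonality is preserved (`Ψ` is an isometry);
* `topologicalClosure_sSup_pull`: the closed span of the pulled family is `⊤` if that of the
  original is (`Ψ` is a homeomorphism);
* `pullEquiv`, `isUnitaryEquiv_pull`: unitary equivalence of constituents is preserved (and the
  classes correspond, `Ψ.symm` intertwining back);
* `exists_decomposition_of_intertwines`: **the transport** — from a decomposition of `E₂` (irreducible,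
  pairwise orthogonal, closed span `⊤`, finite unitary-equivalence classes) to one of `E₁`.

Mathlib only besides rows 49 / 53 (definitions `IrreducibleOn`, `IsUnitaryEquiv`).  Axioms:
propext, Classical.choice, Quot.sound.  README §8(d): uses an L-value-free non-vanishing device: NO.
-/

namespace Summit.Ventures.HodgeRepro2.T5DecompositionTransport

open Summit.Ventures.HodgeRepro2.T5CompactDiscreteDecomposition (IrreducibleOn)
open Summit.Ventures.HodgeRepro2.T5FiniteMultiplicity (IsUnitaryEquiv)
open scoped InnerProductSpace

variable {E₁ E₂ : Type*} [NormedAddCommGroup E₁] [InnerProductSpace ℂ E₁] [NormedAddCommGroup E₂]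
  [InnerProductSpace ℂ E₂] {G : Type*} [Group G]

/-- `Ψ` INTERTWINES `ρ₁` and `ρ₂`: `Ψ (ρ₁ g v) = ρ₂ g (Ψ v)`. -/
def IntertwinesRep (ρ₁ : G →* (E₁ →L[ℂ] E₁)) (ρ₂ : G →* (E₂ →L[ℂ] E₂)) (Ψ : E₁ ≃ₗᵢ[ℂ] E₂) : Prop :=
  ∀ (g : G) (v : E₁), Ψ (ρ₁ g v) = ρ₂ g (Ψ v)

/-- The pulled-back subspace `Ψ⁻¹ U`. -/
def pull (Ψ : E₁ ≃ₗᵢ[ℂ] E₂) (U : Submodule ℂ E₂) : Submodule ℂ E₁ :=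
  U.comap (Ψ.toLinearEquiv : E₁ →ₗ[ℂ] E₂)

/-- Membership in `pull Ψ U`. -/
theorem mem_pull {Ψ : E₁ ≃ₗᵢ[ℂ] E₂} {U : Submodule ℂ E₂} {v : E₁} : v ∈ pull Ψ U ↔ Ψ v ∈ U :=
  Iff.rfl

/-- `pull Ψ U` as a set is the preimage `Ψ ⁻¹' U`. -/
theorem coe_pull (Ψ : E₁ ≃ₗᵢ[ℂ] E₂) (U : Submodule ℂ E₂) :
    (pull Ψ U : Set E₁) = Ψ ⁻¹' (U : Set E₂) :=
  rfl

/-- The pull-back of a closed subspace is closed. -/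
theorem isClosed_pull (Ψ : E₁ ≃ₗᵢ[ℂ] E₂) {U : Submodule ℂ E₂} (hU : IsClosed (U : Set E₂)) :
    IsClosed (pull Ψ U : Set E₁) := by
  rw [coe_pull]
  exact hU.preimage Ψ.continuous

/-- The pull-back of a `ρ₂`-stable subspace is `ρ₁`-stable. -/
theorem stable_pull {ρ₁ : G →* (E₁ →L[ℂ] E₁)} {ρ₂ : G →* (E₂ →L[ℂ] E₂)} {Ψ : E₁ ≃ₗᵢ[ℂ] E₂}
    (hΨ : IntertwinesRep ρ₁ ρ₂ Ψ) {U : Submodule ℂ E₂} (hU : ∀ g, ∀ u ∈ U, ρ₂ g u ∈ U) :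
    ∀ g, ∀ v ∈ pull Ψ U, ρ₁ g v ∈ pull Ψ U := fun g v hv => by
  rw [mem_pull, hΨ g v]
  exact hU g _ (mem_pull.1 hv)

/-- The pull-back of a non-zero subspace is non-zero. -/
theorem pull_ne_bot (Ψ : E₁ ≃ₗᵢ[ℂ] E₂) {U : Submodule ℂ E₂} (hU : U ≠ ⊥) : pull Ψ U ≠ ⊥ := by
  obtain ⟨u, huU, hu0⟩ := Submodule.exists_mem_ne_zero_of_ne_bot hU
  refine (Submodule.ne_bot_iff _).2 ⟨Ψ.symm u, ?_, ?_⟩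
  · rw [mem_pull, Ψ.apply_symm_apply]
    exact huU
  · intro h
    apply hu0
    rw [← Ψ.apply_symm_apply u, h, map_zero]

/-- `pull Ψ` is injective. -/
theorem pull_inj (Ψ : E₁ ≃ₗᵢ[ℂ] E₂) : Function.Injective (pull Ψ) := by
  intro U V h
  ext u
  have h1 : Ψ.symm u ∈ pull Ψ U ↔ Ψ.symm u ∈ pull Ψ V := by rw [h]
  simpa only [mem_pull, Ψ.apply_symm_apply] using h1

/-- The push-forward `Ψ V` of a closed `ρ₁`-stable `V ≤ pull Ψ U` is a closed `ρ₂`-stable subspace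
of `U`; hence the pull-back of an IRREDUCIBLE subspace is irreducible. -/
theorem irreducibleOn_pull {ρ₁ : G →* (E₁ →L[ℂ] E₁)} {ρ₂ : G →* (E₂ →L[ℂ] E₂)}
    {Ψ : E₁ ≃ₗᵢ[ℂ] E₂} (hΨ : IntertwinesRep ρ₁ ρ₂ Ψ) {U : Submodule ℂ E₂}
    (hU : IrreducibleOn ρ₂ U) : IrreducibleOn ρ₁ (pull Ψ U) := by
  obtain ⟨hUc, hUs, hU0, hUmin⟩ := hU
  refine ⟨isClosed_pull Ψ hUc, stable_pull hΨ hUs, pull_ne_bot Ψ hU0, fun V hVU hVc hVs => ?_⟩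
  -- the push-forward `W := Ψ V`
  set W : Submodule ℂ E₂ := V.map (Ψ.toLinearEquiv : E₁ →ₗ[ℂ] E₂) with hW
  have hWV : pull Ψ W = V := by
    simp only [hW, pull]
    exact Submodule.comap_map_eq_of_injective Ψ.injective V
  have hWU : W ≤ U := fun w hw => by
    obtain ⟨v, hvV, rfl⟩ := Submodule.mem_map.1 hw
    exact mem_pull.1 (hVU hvV)
  have hWc : IsClosed (W : Set E₂) := by
    have : (W : Set E₂) = Ψ.toHomeomorph '' (V : Set E₁) := rfl
    rw [this, Homeomorph.isClosed_image]
    exact hVc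
  have hWs : ∀ g, ∀ w ∈ W, ρ₂ g w ∈ W := fun g w hw => by
    obtain ⟨v, hvV, rfl⟩ := Submodule.mem_map.1 hw
    exact Submodule.mem_map.2 ⟨ρ₁ g v, hVs g v hvV, (hΨ g v)⟩
  rcases hUmin W hWU hWc hWs with h | h
  · left
    rw [← hWV, h]
    ext v
    rw [mem_pull, Submodule.mem_bot, Submodule.mem_bot, map_eq_zero_iff _ Ψ.injective]
  · right
    rw [← hWV, h]

/-- Orthogonality is preserved by `pull`. -/
theorem isOrtho_pull (Ψ : E₁ ≃ₗᵢ[ℂ] E₂) {U V : Submodule ℂ E₂} (h : U ⟂ V) :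
    pull Ψ U ⟂ pull Ψ V := by
  rw [Submodule.isOrtho_iff_inner_eq] at h ⊢
  intro u hu v hv
  rw [← Ψ.inner_map_map]
  exact h _ (mem_pull.1 hu) _ (mem_pull.1 hv)

/-- `pull Ψ U` is the image of `U` under `Ψ.symm`. -/
theorem pull_eq_map_symm (Ψ : E₁ ≃ₗᵢ[ℂ] E₂) (U : Submodule ℂ E₂) :
    pull Ψ U = Submodule.map Ψ.toLinearEquiv.symm.toLinearMap U :=
  Submodule.comap_equiv_eq_map_symm Ψ.toLinearEquiv U

/-- `pull Ψ (sSup S) ≤ sSup (pull Ψ '' S)`. -/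
theorem pull_sSup_le (Ψ : E₁ ≃ₗᵢ[ℂ] E₂) (S : Set (Submodule ℂ E₂)) :
    pull Ψ (sSup S) ≤ sSup (pull Ψ '' S) := by
  rw [pull_eq_map_symm, sSup_eq_iSup', Submodule.map_iSup]
  refine iSup_le fun U => ?_
  rw [← pull_eq_map_symm]
  exact le_sSup ⟨U, U.2, rfl⟩

/-- The closed span of the pulled family is `⊤` if the closed span of the family is `⊤`
(`Ψ` is a homeomorphism). -/
theorem topologicalClosure_sSup_pull (Ψ : E₁ ≃ₗᵢ[ℂ] E₂) {S : Set (Submodule ℂ E₂)}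
    (h : (sSup S).topologicalClosure = ⊤) :
    (sSup (pull Ψ '' S)).topologicalClosure = ⊤ := by
  apply Submodule.eq_top_iff'.2
  intro v
  have hv : Ψ v ∈ ((sSup S).topologicalClosure : Set E₂) := h ▸ Submodule.mem_top
  rw [Submodule.topologicalClosure_coe] at hv
  show v ∈ ((sSup (pull Ψ '' S)).topologicalClosure : Set E₁)
  rw [Submodule.topologicalClosure_coe]
  refine closure_mono (pull_sSup_le Ψ S) ?_
  rw [coe_pull]
  have hc : closure (⇑Ψ ⁻¹' ((sSup S : Submodule ℂ E₂) : Set E₂)) =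
      ⇑Ψ ⁻¹' closure ((sSup S : Submodule ℂ E₂) : Set E₂) :=
    (Ψ.toHomeomorph.preimage_closure _).symm
  rw [hc]
  exact hv

/-! ### Transport of unitary equivalences -/

/-- `Ψ` restricted to `pull Ψ U → U`. -/
def pullDown (Ψ : E₁ ≃ₗᵢ[ℂ] E₂) (U : Submodule ℂ E₂) (v : pull Ψ U) : U :=
  ⟨Ψ v, mem_pull.1 v.2⟩

/-- `Ψ.symm` restricted to `U → pull Ψ U`. -/
def pullUp (Ψ : E₁ ≃ₗᵢ[ℂ] E₂) (U : Submodule ℂ E₂) (u : U) : pull Ψ U :=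
  ⟨Ψ.symm u, by
    rw [mem_pull, Ψ.apply_symm_apply]
    exact u.2⟩

/-- `pullUp ∘ pullDown = id`. -/
theorem pullUp_pullDown (Ψ : E₁ ≃ₗᵢ[ℂ] E₂) (U : Submodule ℂ E₂) (v : pull Ψ U) :
    pullUp Ψ U (pullDown Ψ U v) = v :=
  Subtype.ext (Ψ.symm_apply_apply _)

/-- `pullDown ∘ pullUp = id`. -/
theorem pullDown_pullUp (Ψ : E₁ ≃ₗᵢ[ℂ] E₂) (U : Submodule ℂ E₂) (u : U) : pullDown Ψ U (pullUp Ψ U u) = u :=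
  Subtype.ext (Ψ.apply_symm_apply _)

/-- `pullDown` is additive. -/
theorem pullDown_add (Ψ : E₁ ≃ₗᵢ[ℂ] E₂) (U : Submodule ℂ E₂) (v w : pull Ψ U) :
    pullDown Ψ U (v + w) = pullDown Ψ U v + pullDown Ψ U w :=
  Subtype.ext (map_add Ψ (v : E₁) w)

/-- `pullDown` is homogeneous. -/
theorem pullDown_smul (Ψ : E₁ ≃ₗᵢ[ℂ] E₂) (U : Submodule ℂ E₂) (c : ℂ) (v : pull Ψ U) :
    pullDown Ψ U (c • v) = c • pullDown Ψ U v :=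
  Subtype.ext (map_smul Ψ c (v : E₁))

/-- `pullUp` is additive. -/
theorem pullUp_add (Ψ : E₁ ≃ₗᵢ[ℂ] E₂) (U : Submodule ℂ E₂) (u w : U) :
    pullUp Ψ U (u + w) = pullUp Ψ U u + pullUp Ψ U w :=
  Subtype.ext (map_add Ψ.symm (u : E₂) w)

/-- `pullUp` is homogeneous. -/
theorem pullUp_smul (Ψ : E₁ ≃ₗᵢ[ℂ] E₂) (U : Submodule ℂ E₂) (c : ℂ) (u : U) :
    pullUp Ψ U (c • u) = c • pullUp Ψ U u :=
  Subtype.ext (map_smul Ψ.symm c (u : E₂))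

/-- `pullDown` is isometric. -/
theorem norm_pullDown (Ψ : E₁ ≃ₗᵢ[ℂ] E₂) (U : Submodule ℂ E₂) (v : pull Ψ U) :
    ‖pullDown Ψ U v‖ = ‖v‖ := by
  show ‖Ψ (v : E₁)‖ = ‖(v : E₁)‖
  exact Ψ.norm_map _

/-- `pullUp` is isometric. -/
theorem norm_pullUp (Ψ : E₁ ≃ₗᵢ[ℂ] E₂) (U : Submodule ℂ E₂) (u : U) : ‖pullUp Ψ U u‖ = ‖u‖ := by
  show ‖Ψ.symm (u : E₂)‖ = ‖(u : E₂)‖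
  exact Ψ.symm.norm_map _

/-- `pullDown` on points. -/
theorem coe_pullDown (Ψ : E₁ ≃ₗᵢ[ℂ] E₂) (U : Submodule ℂ E₂) (v : pull Ψ U) :
    (pullDown Ψ U v : E₂) = Ψ v :=
  rfl

/-- `pullUp` on points. -/
theorem coe_pullUp (Ψ : E₁ ≃ₗᵢ[ℂ] E₂) (U : Submodule ℂ E₂) (u : U) : (pullUp Ψ U u : E₁) = Ψ.symm u :=
  rfl

/-- The restricted equivalence `Ψ⁻¹ ∘ Φ ∘ Ψ : pull Ψ U₀ ≃ pull Ψ U` of a unitary `Φ : U₀ ≃ U`. -/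
noncomputable def pullEquiv (Ψ : E₁ ≃ₗᵢ[ℂ] E₂) {U₀ U : Submodule ℂ E₂} (Φ : U₀ ≃ₗᵢ[ℂ] U) :
    pull Ψ U₀ ≃ₗᵢ[ℂ] pull Ψ U where
  toFun v := pullUp Ψ U (Φ (pullDown Ψ U₀ v))
  invFun w := pullUp Ψ U₀ (Φ.symm (pullDown Ψ U w))
  map_add' v w := by rw [pullDown_add, map_add, pullUp_add]
  map_smul' c v := by rw [pullDown_smul, map_smul, pullUp_smul, RingHom.id_apply]
  left_inv v := by
    show pullUp Ψ U₀ (Φ.symm (pullDown Ψ U (pullUp Ψ U (Φ (pullDown Ψ U₀ v))))) = v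
    rw [pullDown_pullUp, Φ.symm_apply_apply, pullUp_pullDown]
  right_inv w := by
    show pullUp Ψ U (Φ (pullDown Ψ U₀ (pullUp Ψ U₀ (Φ.symm (pullDown Ψ U w))))) = w
    rw [pullDown_pullUp, Φ.apply_symm_apply, pullUp_pullDown]
  norm_map' v := by
    show ‖pullUp Ψ U (Φ (pullDown Ψ U₀ v))‖ = ‖v‖
    rw [norm_pullUp, Φ.norm_map, norm_pullDown]

/-- `pullEquiv` on points. -/
theorem coe_pullEquiv_apply (Ψ : E₁ ≃ₗᵢ[ℂ] E₂) {U₀ U : Submodule ℂ E₂} (Φ : U₀ ≃ₗᵢ[ℂ] U)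
    (v : pull Ψ U₀) : (pullEquiv Ψ Φ v : E₁) = Ψ.symm (Φ (pullDown Ψ U₀ v)) :=
  rfl

/-- Unitary equivalence of constituents is preserved by `pull`. -/
theorem isUnitaryEquiv_pull {ρ₁ : G →* (E₁ →L[ℂ] E₁)} {ρ₂ : G →* (E₂ →L[ℂ] E₂)}
    {Ψ : E₁ ≃ₗᵢ[ℂ] E₂} (hΨ : IntertwinesRep ρ₁ ρ₂ Ψ) {U₀ U : Submodule ℂ E₂}
    (h : IsUnitaryEquiv ρ₂ U₀ U) : IsUnitaryEquiv ρ₁ (pull Ψ U₀) (pull Ψ U) := by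
  obtain ⟨Φ, hΦ⟩ := h
  refine ⟨pullEquiv Ψ Φ, fun g w hw => ?_⟩
  rw [coe_pullEquiv_apply, coe_pullEquiv_apply]
  set u : U₀ := pullDown Ψ U₀ w with hu
  have hmem : ρ₂ g (u : E₂) ∈ U₀ := by
    rw [hu, coe_pullDown, ← hΨ g w]
    exact mem_pull.1 hw
  -- `pullDown (ρ₁ g w) = ρ₂ g u` in `U₀`
  have h1 : pullDown Ψ U₀ ⟨ρ₁ g w, hw⟩ = ⟨ρ₂ g (u : E₂), hmem⟩ := Subtype.ext (hΨ g w)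
  rw [h1, hΦ g u hmem]
  -- `Ψ.symm (ρ₂ g x) = ρ₁ g (Ψ.symm x)`
  have h2 : ∀ x : E₂, Ψ.symm (ρ₂ g x) = ρ₁ g (Ψ.symm x) := fun x => by
    apply Ψ.injective
    rw [Ψ.apply_symm_apply, hΨ g (Ψ.symm x), Ψ.apply_symm_apply]
  exact h2 _

/-- **The transport**: a decomposition of `E₂` (irreducible, pairwise orthogonal, closed span `⊤`,
finite unitary-equivalence classes) pulls back along an intertwining unitary `Ψ : E₁ ≃ E₂` to a
decomposition of `E₁` of the same shape. -/
theorem exists_decomposition_of_intertwines {ρ₁ : G →* (E₁ →L[ℂ] E₁)}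
    {ρ₂ : G →* (E₂ →L[ℂ] E₂)} {Ψ : E₁ ≃ₗᵢ[ℂ] E₂} (hΨ : IntertwinesRep ρ₁ ρ₂ Ψ)
    (h : ∃ S : Set (Submodule ℂ E₂), (∀ U ∈ S, IrreducibleOn ρ₂ U) ∧
      S.Pairwise (fun U V => U ⟂ V) ∧ (sSup S).topologicalClosure = ⊤ ∧
      ∀ U₀ ∈ S, {U ∈ S | IsUnitaryEquiv ρ₂ U₀ U}.Finite) :
    ∃ S : Set (Submodule ℂ E₁), (∀ U ∈ S, IrreducibleOn ρ₁ U) ∧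
      S.Pairwise (fun U V => U ⟂ V) ∧ (sSup S).topologicalClosure = ⊤ ∧
      ∀ U₀ ∈ S, {U ∈ S | IsUnitaryEquiv ρ₁ U₀ U}.Finite := by
  obtain ⟨S, hSirr, hSo, hStop, hSfin⟩ := h
  refine ⟨pull Ψ '' S, ?_, ?_, topologicalClosure_sSup_pull Ψ hStop, ?_⟩
  · rintro _ ⟨U, hU, rfl⟩
    exact irreducibleOn_pull hΨ (hSirr U hU)
  · rintro _ ⟨U, hU, rfl⟩ _ ⟨V, hV, rfl⟩ hne
    exact isOrtho_pull Ψ (hSo hU hV fun h => hne (h ▸ rfl))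
  · rintro _ ⟨U₀, hU₀, rfl⟩
    -- the class of `pull Ψ U₀` is the image of the class of `U₀` under `pull Ψ`
    refine ((hSfin U₀ hU₀).image (pull Ψ)).subset ?_
    rintro _ ⟨⟨U, hU, rfl⟩, hUeq⟩
    refine ⟨U, ⟨hU, ?_⟩, rfl⟩
    -- transport back along `Ψ.symm` (which intertwines `ρ₂` and `ρ₁`)
    have hΨ' : IntertwinesRep ρ₂ ρ₁ Ψ.symm := fun g x => by
      apply Ψ.injective
      rw [Ψ.apply_symm_apply, hΨ g (Ψ.symm x), Ψ.apply_symm_apply]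
    have := isUnitaryEquiv_pull hΨ' hUeq
    -- `pull Ψ.symm (pull Ψ V) = V`
    have hpp : ∀ V : Submodule ℂ E₂, pull Ψ.symm (pull Ψ V) = V := fun V => by
      ext x
      simp only [mem_pull, LinearIsometryEquiv.apply_symm_apply]
    rwa [hpp, hpp] at this

end Summit.Ventures.HodgeRepro2.T5DecompositionTransport
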